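import Mathlib
import Literature.Computability.Complexity.CliqueTestGraphs
import Summits.PneNP.PneNP.Theorems.ConvexRankGatesConvexGateBlindRowsCount

/-!
# PneNP / ConvexRankGates — `ConvexGateBlind`: the row lower bound for single CONV gates

Helpers (`--supports stmt-PneNP-10680`). A single CONV gate of the route,
`x ↦ [∃ Y ⪰ 0 (q × q), tr(Aᵢ Y) ≤ bᵢ + ∑ₑ Bᵢₑ [xₑ] ∀ i < p]` with `B ≥ 0`, reads its input only
through the `p` non-negative measurements `(B 𝟙ₓ)ᵢ`, and feasibility is monotone in them; so if it
computes `CLIQUE(m, k)` then for every `k`-clique `K` and every complete `(k-1)`-partite graph `G_h`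
some row has `Bᵢ(G_h) < Bᵢ(K)` (`rows_sep_of_computes`). The double count of
`ConvexRankGatesConvexGateBlindRowsCount.lean` then bounds the number of ROWS from below:
* `rows_bound_of_computes`: `(k-1)^g (m²-m) ≤ p (2(k²+2(g+k)g)(k-1)^g + m²-m)` for every `g ≤ m`,
  whatever `q`, `A`, `b`;
* `singleGateBlind_pow_one`: consequently, for EVERY `δ ∈ (0, 1/2)`, eventually in `m` no single CONV
  gate with `p + q ≤ m` computes `CLIQUE(m, ⌈m^δ⌉₊)` — the `c = 1` case of the single-gate form of
  the crux (`convexGateBlind_of_singleGate` needs all `c`; `c = 0` is trivial). The method stops at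
  `c = 1`: the identity measurement (`p = |E(K_m)|`) passes the bottleneck, so `c ≥ 2` needs the
  semidefinite part.
-/

namespace Summit.PneNP.PneNP.Theorems

open Finset

section clique

open Literature.Computability.Complexity Filter
open scoped Classical

/-- **Measurement bottleneck.** If a CONV gate `x ↦ [∃ Y ⪰ 0, tr(Aᵢ Y) ≤ bᵢ + (B 𝟙ₓ)ᵢ]` computes
`CLIQUE(m, c'+2)`, then for every `(c'+2)`-set `S` and every `(c'+1)`-colouring `h` some row `i`
gives the complete multipartite graph of `h` LESS `Bᵢ`-weight than the clique on `S` — otherwise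
the clique's PSD witness would also certify the (clique-free) multipartite graph, feasibility being
monotone in the right-hand side. Stated on unordered pairs (`Bᵢ` extended by `0` to loops). [folklore] -/
theorem rows_sep_of_computes {m c' p q : ℕ} (A : Fin p → Matrix (Fin q) (Fin q) ℝ) (b : Fin p → ℝ)
    (B : Fin p → (⊤ : SimpleGraph (Fin m)).edgeSet → ℝ)
    (hgate : ∀ x : (⊤ : SimpleGraph (Fin m)).edgeSet → Bool, cliqueFn m (c' + 2) x = true ↔
      ∃ Y : Matrix (Fin q) (Fin q) ℝ, Y.PosSemidef ∧
        ∀ i, (A i * Y).trace ≤ b i + ∑ e, B i e * (if x e then (1 : ℝ) else 0))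
    (S : Finset (Fin m)) (hS : S.card = c' + 2) (h : Fin m → Fin (c' + 1)) :
    ∃ i, (∑ f ∈ univ.filter (fun f : Sym2 (Fin m) => ¬ f.IsDiag),
        (if (f.map h).IsDiag then 0 else
          (if hf : f ∈ (⊤ : SimpleGraph (Fin m)).edgeSet then B i ⟨f, hf⟩ else 0))) <
      ∑ f ∈ univ.filter (fun f : Sym2 (Fin m) => ¬ f.IsDiag),
        (if (∀ v ∈ f, v ∈ S) then
          (if hf : f ∈ (⊤ : SimpleGraph (Fin m)).edgeSet then B i ⟨f, hf⟩ else 0) else 0) := by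
  have hEd : ∀ f : Sym2 (Fin m), f ∈ univ.filter (fun f : Sym2 (Fin m) => ¬ f.IsDiag) ↔
      f ∈ (⊤ : SimpleGraph (Fin m)).edgeSet := by
    intro f
    simp [SimpleGraph.edgeSet_top]
  -- translate the two sums to sums over the edge type
  have hsum1 : ∀ i, (∑ e, B i e * (if colorVec h e then (1 : ℝ) else 0)) =
      ∑ f ∈ univ.filter (fun f : Sym2 (Fin m) => ¬ f.IsDiag),
        (if (f.map h).IsDiag then 0 else
          (if hf : f ∈ (⊤ : SimpleGraph (Fin m)).edgeSet then B i ⟨f, hf⟩ else 0)) := by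
    intro i
    rw [Finset.sum_subtype _ hEd]
    refine Finset.sum_congr rfl fun e _ => ?_
    rw [dif_pos e.2]
    simp only [colorVec, Bool.not_eq_true', decide_eq_false_iff_not, Subtype.coe_eta]
    split_ifs <;> simp
  have hsum2 : ∀ i, (∑ e, B i e * (if cliqueVec S e then (1 : ℝ) else 0)) =
      ∑ f ∈ univ.filter (fun f : Sym2 (Fin m) => ¬ f.IsDiag),
        (if (∀ v ∈ f, v ∈ S) then
          (if hf : f ∈ (⊤ : SimpleGraph (Fin m)).edgeSet then B i ⟨f, hf⟩ else 0) else 0) := by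
    intro i
    rw [Finset.sum_subtype _ hEd]
    refine Finset.sum_congr rfl fun e _ => ?_
    rw [dif_pos e.2]
    simp only [cliqueVec, decide_eq_true_eq, Subtype.coe_eta]
    split_ifs <;> simp
  by_contra hall
  push Not at hall
  simp only [← hsum1, ← hsum2] at hall
  -- the clique on `S` is accepted, hence so is the multipartite graph of `h`
  obtain ⟨Y, hY, hrows⟩ := (hgate (cliqueVec S)).1 (cliqueFn_cliqueVec hS.ge)
  have hacc : cliqueFn m (c' + 2) (colorVec h) = true :=
    (hgate (colorVec h)).2 ⟨Y, hY, fun i => (hrows i).trans (by linarith [hall i])⟩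
  rw [cliqueFn_colorVec h (by omega)] at hacc
  exact Bool.false_ne_true hacc

/-- **Row bound for a single CONV gate computing CLIQUE.** If `(A, b, B ≥ 0)` with `p` rows computes
`CLIQUE(m, k)`, `k = c' + 2 ≤ m`, then for every `g ≤ m`,
`(k-1)^g · (m² - m) ≤ p · (2 (k² + 2(g+k)g) (k-1)^g + (m² - m))` (`rows_count` with the
`(k-1)`-colourings as negatives). [folklore] -/
theorem rows_bound_of_computes {m c' p q g : ℕ} (hm : c' + 2 ≤ m) (hgm : g ≤ m)
    (A : Fin p → Matrix (Fin q) (Fin q) ℝ) (b : Fin p → ℝ)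
    (B : Fin p → (⊤ : SimpleGraph (Fin m)).edgeSet → ℝ) (hB : ∀ i e, 0 ≤ B i e)
    (hgate : ∀ x : (⊤ : SimpleGraph (Fin m)).edgeSet → Bool, cliqueFn m (c' + 2) x = true ↔
      ∃ Y : Matrix (Fin q) (Fin q) ℝ, Y.PosSemidef ∧
        ∀ i, (A i * Y).trace ≤ b i + ∑ e, B i e * (if x e then (1 : ℝ) else 0)) :
    (c' + 1) ^ g * (m * m - m) ≤
      p * (2 * ((c' + 2) ^ 2 + 2 * (g + (c' + 2)) * g) * (c' + 1) ^ g + (m * m - m)) := by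
  have hOD : (univ : Finset (Fin m)).offDiag.card = m * m - m := by
    rw [Finset.offDiag_card, Finset.card_univ, Fintype.card_fin]
  have := rows_count (k := c' + 2) (c' := c') (g := g) (r₁ := (c' + 2) ^ 2 + 2 * (g + (c' + 2)) * g)
    (by omega) hm (by omega) hgm
    (fun i (f : Sym2 (Fin m)) => if hf : f ∈ (⊤ : SimpleGraph (Fin m)).edgeSet then B i ⟨f, hf⟩ else 0)
    (fun i f => by
      split_ifs
      · exact hB _ _
      · exact le_refl _)
    le_rfl (fun S hS h => rows_sep_of_computes A b B hgate S hS h)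
  rwa [hOD] at this

/-! ### Asymptotics and the `c = 1` case of the single-gate form of the crux -/

/-- `L · m^{2δ} ≤ m` eventually, for `2δ < 1`. [folklore] -/
theorem eventually_mul_rpow_two_mul_le {δ : ℝ} (hδ1 : δ < 1 / 2) (L : ℝ) (hL : 0 < L) :
    ∀ᶠ m : ℕ in atTop, L * (m : ℝ) ^ (2 * δ) ≤ m := by
  have h1 : Tendsto (fun x : ℝ => x ^ (-(1 - 2 * δ))) atTop (nhds 0) :=
    tendsto_rpow_neg_atTop (by linarith)
  have h2 : Tendsto (fun m : ℕ => (m : ℝ) ^ (-(1 - 2 * δ))) atTop (nhds 0) :=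
    h1.comp tendsto_natCast_atTop_atTop
  have h3 : ∀ᶠ m : ℕ in atTop, (m : ℝ) ^ (-(1 - 2 * δ)) < 1 / L :=
    h2.eventually (gt_mem_nhds (by positivity))
  filter_upwards [h3, eventually_ge_atTop 1] with m hm hm1
  have hm0 : (0 : ℝ) < m := by exact_mod_cast hm1
  have hsplit : (m : ℝ) ^ (2 * δ) = m * (m : ℝ) ^ (-(1 - 2 * δ)) := by
    calc (m : ℝ) ^ (2 * δ) = (m : ℝ) ^ ((1 : ℝ) + (-(1 - 2 * δ))) := by congr 1; ring
      _ = (m : ℝ) ^ (1 : ℝ) * (m : ℝ) ^ (-(1 - 2 * δ)) := Real.rpow_add hm0 _ _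
      _ = m * (m : ℝ) ^ (-(1 - 2 * δ)) := by rw [Real.rpow_one]
  rw [hsplit]
  have h4 : L * (m : ℝ) ^ (-(1 - 2 * δ)) ≤ 1 := by
    have := mul_lt_mul_of_pos_left hm hL
    rw [mul_one_div_cancel hL.ne'] at this
    exact this.le
  calc L * (m * (m : ℝ) ^ (-(1 - 2 * δ))) = m * (L * (m : ℝ) ^ (-(1 - 2 * δ))) := by ring
    _ ≤ m * 1 := mul_le_mul_of_nonneg_left h4 hm0.le
    _ = m := mul_one _

/-- The eventual numerical conditions of the row bound: `k = ⌈m^δ⌉₊ ≥ 3`, `k ≤ m`, `g ≤ m`,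
`4m (k² + 2(g+k)g) ≤ m² - m` (uses `2δ < 1`) and `2m < (k-1)^g` (uses `δ g ≥ 3`). [folklore] -/
theorem eventually_rows_conditions {δ : ℝ} (hδ0 : 0 < δ) (hδ1 : δ < 1 / 2) (g : ℕ)
    (hg : 3 ≤ δ * g) :
    ∀ᶠ m : ℕ in atTop, 3 ≤ ⌈(m : ℝ) ^ δ⌉₊ ∧ ⌈(m : ℝ) ^ δ⌉₊ ≤ m ∧ g ≤ m ∧
      4 * m * (⌈(m : ℝ) ^ δ⌉₊ ^ 2 + 2 * (g + ⌈(m : ℝ) ^ δ⌉₊) * g) ≤ m * m - m ∧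
      2 * m < (⌈(m : ℝ) ^ δ⌉₊ - 1) ^ g := by
  have hx : Tendsto (fun m : ℕ => (m : ℝ) ^ δ) atTop atTop :=
    (tendsto_rpow_atTop hδ0).comp tendsto_natCast_atTop_atTop
  filter_upwards [hx.eventually_ge_atTop 3,
    eventually_mul_rpow_two_mul_le hδ1 (32 + 32 * g) (by positivity),
    eventually_ge_atTop (16 * g ^ 2 + 2), eventually_ge_atTop (2 ^ (g + 1) + 1),
    eventually_ge_atTop g, eventually_ge_atTop 3] with m hx3 hsmall hmg2 hm2g hmg hm3
  set x : ℝ := (m : ℝ) ^ δ with hxdef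
  set k : ℕ := ⌈x⌉₊ with hk
  have hx0 : 0 ≤ x := by positivity
  have hxk : x ≤ k := Nat.le_ceil x
  have hkx : (k : ℝ) < x + 1 := Nat.ceil_lt_add_one hx0
  have hm1 : (1 : ℝ) ≤ m := by exact_mod_cast (show 1 ≤ m by omega)
  have hk3 : 3 ≤ k := by
    have : (3 : ℝ) ≤ k := hx3.trans hxk
    exact_mod_cast this
  -- `k ≤ m`
  have hxm : x ≤ m := by
    calc x = (m : ℝ) ^ δ := rfl
      _ ≤ (m : ℝ) ^ (1 : ℝ) := Real.rpow_le_rpow_of_exponent_le hm1 (by linarith)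
      _ = m := Real.rpow_one _
  have hkm : k ≤ m := by
    have : k ≤ ⌈(m : ℝ)⌉₊ := Nat.ceil_mono hxm
    rwa [Nat.ceil_natCast] at this
  -- `4 (k² + 2(g+k)g) + 1 ≤ m`
  have hx1 : 1 ≤ x := by linarith
  have hk2x : (k : ℝ) ≤ 2 * x := by linarith
  have hx2 : x ^ 2 = (m : ℝ) ^ (2 * δ) := by
    rw [hxdef, ← Real.rpow_natCast, ← Real.rpow_mul (Nat.cast_nonneg m)]
    congr 1
    push_cast
    ring
  have hd_real : (4 * (k ^ 2 + 2 * (g + k) * g) : ℝ) + 1 ≤ m := by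
    have hg0 : (0 : ℝ) ≤ g := Nat.cast_nonneg g
    have hk0 : (0 : ℝ) ≤ k := Nat.cast_nonneg k
    have hxx : x ≤ x ^ 2 := by nlinarith
    have hkk : (k : ℝ) ^ 2 ≤ 4 * x ^ 2 := by nlinarith
    have hgk : (g : ℝ) * k ≤ 2 * g * x ^ 2 := by
      calc (g : ℝ) * k ≤ g * (2 * x) := mul_le_mul_of_nonneg_left hk2x hg0
        _ ≤ g * (2 * x ^ 2) := by
          apply mul_le_mul_of_nonneg_left _ hg0
          linarith
        _ = 2 * g * x ^ 2 := by ring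
    have h1 : (4 * (k ^ 2 + 2 * (g + k) * g) : ℝ) ≤ (16 + 16 * g) * x ^ 2 + 8 * g ^ 2 := by
      have : (4 * (k ^ 2 + 2 * (g + k) * g) : ℝ) = 4 * k ^ 2 + 8 * g ^ 2 + 8 * (g * k) := by ring
      rw [this]
      nlinarith
    have h2 : (16 + 16 * g) * x ^ 2 ≤ m / 2 := by
      rw [hx2]
      linarith
    have h3 : (8 * g ^ 2 : ℝ) + 1 ≤ m / 2 := by
      have : ((16 * g ^ 2 + 2 : ℕ) : ℝ) ≤ m := by exact_mod_cast hmg2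
      push_cast at this
      linarith
    linarith
  have hd : 4 * m * (k ^ 2 + 2 * (g + k) * g) ≤ m * m - m := by
    have hd' : 4 * (k ^ 2 + 2 * (g + k) * g) + 1 ≤ m := by exact_mod_cast hd_real
    have : 4 * m * (k ^ 2 + 2 * (g + k) * g) + m ≤ m * m := by
      calc 4 * m * (k ^ 2 + 2 * (g + k) * g) + m = m * (4 * (k ^ 2 + 2 * (g + k) * g) + 1) := by ring
        _ ≤ m * m := Nat.mul_le_mul_left _ hd'
    exact Nat.le_sub_of_add_le this
  -- `2 m < (k - 1)^g`
  have he : 2 * m < (k - 1) ^ g := by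
    have hk1 : ((k - 1 : ℕ) : ℝ) = (k : ℝ) - 1 := by
      rw [Nat.cast_sub (by omega)]
      simp
    have h1 : x / 2 ≤ ((k - 1 : ℕ) : ℝ) := by
      rw [hk1]
      linarith
    have h2 : (x / 2) ^ g ≤ ((k - 1 : ℕ) : ℝ) ^ g := by
      have : 0 ≤ x / 2 := by positivity
      gcongr
    have h3 : (m : ℝ) ^ 3 ≤ x ^ g := by
      rw [hxdef, ← Real.rpow_natCast ((m : ℝ) ^ δ) g, ← Real.rpow_mul (Nat.cast_nonneg m)]
      calc (m : ℝ) ^ 3 = (m : ℝ) ^ ((3 : ℕ) : ℝ) := by rw [Real.rpow_natCast]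
        _ ≤ (m : ℝ) ^ (δ * g) := Real.rpow_le_rpow_of_exponent_le hm1 (by push_cast; linarith)
    have h4 : (2 * m : ℝ) < (x / 2) ^ g := by
      rw [div_pow, lt_div_iff₀ (by positivity)]
      have hm2 : ((2 ^ (g + 1) + 1 : ℕ) : ℝ) ≤ m := by exact_mod_cast hm2g
      push_cast at hm2
      have hmpos : (0 : ℝ) < m := by linarith
      calc (2 * m : ℝ) * 2 ^ g = m * 2 ^ (g + 1) := by ring
        _ < m * m := by
          apply mul_lt_mul_of_pos_left _ hmpos
          linarith
        _ ≤ m * m * m := by nlinarith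
        _ = (m : ℝ) ^ 3 := by ring
        _ ≤ x ^ g := h3
    have : (2 * m : ℝ) < ((k - 1 : ℕ) : ℝ) ^ g := h4.trans_le h2
    exact_mod_cast this
  exact ⟨hk3, hkm, hmg, hd, he⟩

/-- **The single-gate form of the crux holds at `c = 1`, for EVERY `δ ∈ (0, 1/2)`.** Eventually in
`m`, no single CONV gate `x ↦ [∃ Y ⪰ 0, tr(Aᵢ Y) ≤ bᵢ + (B 𝟙ₓ)ᵢ]` with `B ≥ 0` and `p + q ≤ m`
computes `CLIQUE(m, ⌈m^δ⌉₊)` — whatever the real data `A, b` and whatever `q`: the `p ≤ m` rows of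
`B` cannot separate every clique from every complete `(⌈m^δ⌉₊ - 1)`-partite graph
(`rows_bound_of_computes` with `g = ⌈3/δ⌉₊` private pairs). This is the first case of the crux's
single-gate form (`convexGateBlind_of_singleGate` needs it for all `c`) beyond the trivial `c = 0`;
it fails for `c ≥ 2` by this method alone, since the identity measurement `B` (one row per edge,
`p = |E(K_m)| ≤ m²`) passes the measurement bottleneck. [folklore] -/
theorem singleGateBlind_pow_one {δ : ℝ} (hδ0 : 0 < δ) (hδ1 : δ < 1 / 2) :
    ∀ᶠ m : ℕ in atTop, ∀ (p q : ℕ), p + q ≤ m ^ 1 →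
      ∀ (A : Fin p → Matrix (Fin q) (Fin q) ℝ) (b : Fin p → ℝ)
        (B : Fin p → (⊤ : SimpleGraph (Fin m)).edgeSet → ℝ), (∀ i e, 0 ≤ B i e) →
        ¬ ∀ x : (⊤ : SimpleGraph (Fin m)).edgeSet → Bool,
          decide (¬ (SimpleGraph.fromEdgeSet {e : Sym2 (Fin m) |
            ∃ h : e ∈ (⊤ : SimpleGraph (Fin m)).edgeSet, x ⟨e, h⟩ = true}).CliqueFree
              ⌈(m : ℝ) ^ δ⌉₊) = true ↔
          ∃ Y : Matrix (Fin q) (Fin q) ℝ, Y.PosSemidef ∧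
            ∀ i, (A i * Y).trace ≤ b i + ∑ e, B i e * (if x e then (1 : ℝ) else 0) := by
  set g : ℕ := ⌈3 / δ⌉₊ with hgdef
  have hg : 3 ≤ δ * g := by
    have : 3 / δ ≤ g := Nat.le_ceil _
    rw [div_le_iff₀ hδ0] at this
    linarith
  filter_upwards [eventually_rows_conditions hδ0 hδ1 g hg] with m hcond p q hpq A b B hB hgate
  obtain ⟨hk3, hkm, hgm, hR, hC⟩ := hcond
  obtain ⟨c', hc'⟩ : ∃ c', ⌈(m : ℝ) ^ δ⌉₊ = c' + 2 := ⟨⌈(m : ℝ) ^ δ⌉₊ - 2, by omega⟩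
  have hgate' : ∀ x : (⊤ : SimpleGraph (Fin m)).edgeSet → Bool, cliqueFn m (c' + 2) x = true ↔
      ∃ Y : Matrix (Fin q) (Fin q) ℝ, Y.PosSemidef ∧
        ∀ i, (A i * Y).trace ≤ b i + ∑ e, B i e * (if x e then (1 : ℝ) else 0) := by
    intro x
    rw [← hc']
    exact hgate x
  have H := rows_bound_of_computes (by omega : c' + 2 ≤ m) hgm A b B hB hgate'
  rw [hc', show c' + 2 - 1 = c' + 1 from rfl] at hC
  rw [hc'] at hR
  have hp : p ≤ m := by
    rw [pow_one] at hpq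
    omega
  -- `C M ≤ p (2 R C + M)`, `p ≤ m`, `4 m R ≤ M`, `2 m < C` are contradictory
  have h1 := H.trans (Nat.mul_le_mul_right _ hp)
  have hM : 0 < m * m - m := by
    have : 3 ≤ m := by omega
    have : m + 6 ≤ m * m := by nlinarith
    omega
  nlinarith [Nat.mul_le_mul_right ((c' + 1) ^ g) hR, Nat.mul_le_mul_right (m * m - m) hC.le, hM,
    Nat.zero_le ((c' + 1) ^ g), Nat.zero_le ((c' + 2) ^ 2 + 2 * (g + (c' + 2)) * g)]

end clique

end Summit.PneNP.PneNP.Theorems
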